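import Mathlib
import HarnessLib
import Summits.HubbardSuperconductivity.HubbardSuperconductivity.Theorems.KLProgrammeKLRegimeEngineV8TowerParts

/-!
# Route `KLProgramme` — ENGINE child gen 8 (stmt-HubbardSuperconductivity-20437 `KLRegimeEngineV17F2`), skeleton v2, stub (b) under TABLE B′-DEFERRED:
# the ATOM-GENERIC tower deliverable `TowerNormsStepG … Grid`, its atom-free core package and the generic closer (E1 kit part 16; E1 lead r2d-p2 g8)

Pre-staged on the pen's GO (plan g20 (R66)(2), 2026-08-27): located risk #9 puts conjunct (4) of (b) v2 — the grid two-leg moments atom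
`TwoLegGridFlowMomentsAt L M Zt Zs β U μ n` at the (A)-literal budgets — before a currency decision on 08-28 ((T′-B): a parametrised atom
`TwoLegGridFlowMomentsAtC L M Zt Zs₁ Zs₂ c β U μ n`; or (c)+(W): same arity, another literal).  Its readers in the E1 files are `…TowerCEDefs.TowerNormsStep`
(conj. 4 verbatim) and `…TowerParts.TowerGridMomentsStep`; ANY change of its rendered text needs successors of both.  This file makes either branch a ONE-LINE
INSTANTIATION and makes the tower's PUBLIC CONSTANT atom-free:
* §1 **`GridAtom`** := `∀ (L M : ℕ) [NeZero L] [NeZero M], ℝ → ℝ → ℝ → ℝ → ℕ → Prop`, applied as `Grid L M cc β U μ n` (the step's own binders; `cc` because the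
  (T′-B) atom reads the stub binder `c`); **`klGridAtomA R`** := the atom OF RECORD; **`TowerNormsStepG P R Q₀ CE u Grid`** := `TowerNormsStep` with conj. 4 :=
  `Grid L M cc β U μ n`; **`TowerGridMomentsStepG … Grid`** likewise; `towerNormsStepG_klGridAtomA_iff` / `towerGridMomentsStepG_klGridAtomA_iff` (`Iff.rfl` — at the
  atom of record the generic predicates ARE the predicates of record: the (A)(iv) costume check by unfolding); rows `.mono_CE/.anti_u/.mono_grid`,
  `TowerGridMomentsStepG.of_le_key` (a grid threshold below the key's own `CE` is inert); projections; the atom-generic assembly **`towerNormsStepG_of_parts`** /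
  **`exists_towerPkgG_of_parts`** (part 12's proof).
* §2 **Atom-free core + generic package.**  `TowerCoreStep := TowerLevelsStep ∧ TowerFirstMomentsStep` (conj. 2–3; no atom); **`klTowerCorePkg P R`** := some
  admissible core package at `klEngQ8 P R` if one exists, else the default; **`klTowerCoreCE P R`**, **`klTowerCoreU P R`** + rows; **`klTowerGridU P R Grid`** := some
  everywhere-positive threshold serving the grid part for EVERY raise of the key (threshold `(klEngQ8 P R).CE`: the grid output carries fixed literals, so a
  `CE`-threshold cannot help its producer — its `Q`-dependence goes into `u`, as the class-#4 adapter's already does), else `1`; **`klTowerUG P R Grid :=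
  klTowerCoreU ⊓ klTowerGridU Grid`**.  **THE GENERIC CLOSER `towerNormsStepG_klTowerG_of_exists`**: `P.WF → R.WF2 → (∃ core package) → (∃ key-threshold grid
  package) → TowerNormsStepG P R (klEngQ8 P R) (klTowerCoreCE P R) (klTowerUG P R Grid) Grid` — the PUBLIC CONSTANT DOES NOT READ THE ATOM; only the threshold does.
* §3 **Both tables from the same two inputs**: `exists_towerPkg_of_core_grid` / `towerNormsStep_klTower_of_core_grid` — at the atom of record the two packages
  give today's `∃ e, IsTowerPkg e ∧ TowerNormsStep P R (klEngQ8 P R) e.1 e.2` (DefsQ9 `e_T := max Q8.CE klTowerCE` UNCHANGED if conj. 4's text does not move); if it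
  moves, the successor rows are `klEngQ9cCE := max (klEngQ8 P R).CE (klTowerCoreCE P R)` (atom-free: the LAST motion of token #13 whatever atom is frozen) and the
  DefsU11 row `⊓ klTowerUG P R (klTowerGrid P R) (klEngQ9c P R) cc`, with `klTowerGrid P R : GridAtom` the frozen atom.

Definitions with bodies + compositions of landed theorems; nothing about the model is asserted; nothing asserts superconductivity.
References: BGM 2006 §2.8 (2.83), Lemma 2.5 (2.98), §3 (3.2)–(3.8) [cite: BenfattoGiulianiMastropietro2006].
-/

noncomputable section

namespace Summit.HubbardSuperconductivity.HubbardSuperconductivity.Theorems.EngineV8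

set_option linter.dupNamespace false -- summit = problem name (single-conjunct summit), D-0017

open Real Finset Literature.MathematicalPhysics.QuantumLattice Literature.Probability.LatticeModels
open Literature.MathematicalPhysics.QuantumLattice.FermiRG
open Summit.HubbardSuperconductivity.HubbardSuperconductivity.Theorems.KLRegimeSplit
open Summit.HubbardSuperconductivity.HubbardSuperconductivity.Theorems.KLProgrammeLegKernels
open Summit.HubbardSuperconductivity.HubbardSuperconductivity.Theorems.DispersionFlow

/-! ## §1 Grid atoms, the atom-generic deliverable and its grid part -/

/-- **A grid atom**: the shape of conjunct (4) of (b) v2 as a function of the step's own binders, applied as `Grid L M cc β U μ n`. -/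
abbrev GridAtom : Type := ∀ (L M : ℕ) [NeZero L] [NeZero M], ℝ → ℝ → ℝ → ℝ → ℕ → Prop

/-- **The atom OF RECORD** (today's conjunct (4) of (b) v2 / `TowerNormsStep`): `TwoLegGridFlowMomentsAt` at the pen's (A)-literal budgets
`2^10|2^11 · e^18 · √(2·(7+1606732))⁴ · klE3Acum R` (it does not read `cc`). -/
def klGridAtomA (R : RenConsts) : GridAtom := fun L M _ _ _ β U μ n =>
  TwoLegGridFlowMomentsAt L M ((2 : ℝ) ^ 10 * Real.exp 1 ^ 18 * Real.sqrt (2 * (7 + 1606732)) ^ 4 * klE3Acum R)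
    ((2 : ℝ) ^ 11 * Real.exp 1 ^ 18 * Real.sqrt (2 * (7 + 1606732)) ^ 4 * klE3Acum R) β U μ n

/-- **`TowerNormsStepG P R Q₀ CE u Grid`** — `TowerNormsStep P R Q₀ CE u` with conjunct (4) replaced by the atom `Grid L M cc β U μ n`; every binder and the
conjuncts (1)–(3) VERBATIM. -/
def TowerNormsStepG (P : SplitConsts) (R : RenConsts) (Q₀ : EngConsts) (CE : ℝ) (u : EngConsts → ℝ → ℝ) (Grid : GridAtom) : Prop :=
  ∀ Q : EngConsts, Q₀.IsRaiseOf Q → CE ≤ Q.CE →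
    ∀ cc : ℝ, 0 < cc → cc ≤ klEngC₃6 P R →
      ∀ μ ∈ klWindowC, ∀ U : ℝ, 0 < U → U ≤ klEngU₀10 P R cc → U ≤ u Q cc →
        ∀ β : ℝ, klBetaMin ≤ β → β ≤ Real.exp (cc / U ^ 2) →
          ∀ (L M : ℕ) [NeZero L] [NeZero M], klEngL₄ P R β U ≤ L → klEngM₃ β U L ≤ M →
            ∀ n : ℕ, 1 ≤ n → n ≤ nScales β + 1 → IsKLRegime U cc (-(n : ℤ)) →
              HistP klPredsV17F2 L M klEngGeo8 P Q R β U μ 0 n →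
                FrameOK R U (nScales β) μ (klFlowFrameU L M β U μ n) →
                  (∀ j ≤ n, LevelsUExportMixedAt L M (klCU2 P R (klEngQ7 P R)) P β U μ j) →
                    KernelNormsV4 L M P Q β U μ (klFlowFrameU L M β U μ n) n ∧
                      (∀ j ≤ n, (KernelNormsLevels L M P Q β U μ (klFlowFrameU L M β U μ n) j ∧
                        KernelNormsWt4 L M (klWtBudget P Q U j) β U μ (klFlowFrameU L M β U μ n) j)) ∧
                      EngineFirstMoments L M klEngGeo8 P Q β U μ (klFlowFrameU L M β U μ n) n ∧
                      Grid L M cc β U μ n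

/-- **`TowerGridMomentsStepG P R Q₀ CE u Grid`** — the grid part `TowerGridMomentsStep` with its conclusion replaced by the atom `Grid L M cc β U μ n`. -/
def TowerGridMomentsStepG (P : SplitConsts) (R : RenConsts) (Q₀ : EngConsts) (CE : ℝ) (u : EngConsts → ℝ → ℝ) (Grid : GridAtom) : Prop :=
  ∀ Q : EngConsts, Q₀.IsRaiseOf Q → CE ≤ Q.CE →
    ∀ cc : ℝ, 0 < cc → cc ≤ klEngC₃6 P R →
      ∀ μ ∈ klWindowC, ∀ U : ℝ, 0 < U → U ≤ klEngU₀10 P R cc → U ≤ u Q cc →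
        ∀ β : ℝ, klBetaMin ≤ β → β ≤ Real.exp (cc / U ^ 2) →
          ∀ (L M : ℕ) [NeZero L] [NeZero M], klEngL₄ P R β U ≤ L → klEngM₃ β U L ≤ M →
            ∀ n : ℕ, 1 ≤ n → n ≤ nScales β + 1 → IsKLRegime U cc (-(n : ℤ)) →
              HistP klPredsV17F2 L M klEngGeo8 P Q R β U μ 0 n →
                FrameOK R U (nScales β) μ (klFlowFrameU L M β U μ n) →
                  (∀ j ≤ n, LevelsUExportMixedAt L M (klCU2 P R (klEngQ7 P R)) P β U μ j) →
                    Grid L M cc β U μ n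

section Rows

variable {P : SplitConsts} {R : RenConsts} {Q₀ : EngConsts} {CE CE' : ℝ} {u u' : EngConsts → ℝ → ℝ} {Grid Grid' : GridAtom}

/-- **Costume check by unfolding**: at the atom of record the generic deliverable IS `TowerNormsStep` (definitionally). -/
theorem towerNormsStepG_klGridAtomA_iff : TowerNormsStepG P R Q₀ CE u (klGridAtomA R) ↔ TowerNormsStep P R Q₀ CE u := Iff.rfl

/-- At the atom of record the generic grid part IS `TowerGridMomentsStep` (definitionally). -/
theorem towerGridMomentsStepG_klGridAtomA_iff : TowerGridMomentsStepG P R Q₀ CE u (klGridAtomA R) ↔ TowerGridMomentsStep P R Q₀ CE u := Iff.rfl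

/-- `TowerNormsStepG` is monotone in the candidate constant (fewer raises qualify). -/
theorem TowerNormsStepG.mono_CE (h : TowerNormsStepG P R Q₀ CE u Grid) (hle : CE ≤ CE') : TowerNormsStepG P R Q₀ CE' u Grid :=
  fun Q hQ hCE => h Q hQ (hle.trans hCE)

/-- `TowerNormsStepG` is antitone in the threshold. -/
theorem TowerNormsStepG.anti_u (h : TowerNormsStepG P R Q₀ CE u Grid) (hle : ∀ Q cc, u' Q cc ≤ u Q cc) : TowerNormsStepG P R Q₀ CE u' Grid :=
  fun Q hQ hCE cc hcc hcc6 μ hμ U hU hU10 hUu => h Q hQ hCE cc hcc hcc6 μ hμ U hU hU10 (hUu.trans (hle Q cc))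

/-- `TowerNormsStepG` is monotone in the atom: a pointwise WEAKER atom is served by the same package. -/
theorem TowerNormsStepG.mono_grid (h : TowerNormsStepG P R Q₀ CE u Grid)
    (hG : ∀ (L M : ℕ) [NeZero L] [NeZero M] (cc β U μ : ℝ) (n : ℕ), Grid L M cc β U μ n → Grid' L M cc β U μ n) :
    TowerNormsStepG P R Q₀ CE u Grid' := by
  intro Q hQ hCE cc hcc hcc6 μ hμ U hU hU10 hUu β hβ hβc L M _ _ hL hM n hn1 hn hreg hhist hfr hlevU
  obtain ⟨h1, h2, h3, h4⟩ := h Q hQ hCE cc hcc hcc6 μ hμ U hU hU10 hUu β hβ hβc L M hL hM n hn1 hn hreg hhist hfr hlevU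
  exact ⟨h1, h2, h3, hG L M cc β U μ n h4⟩

/-- `TowerGridMomentsStepG` is monotone in the candidate constant. -/
theorem TowerGridMomentsStepG.mono_CE (h : TowerGridMomentsStepG P R Q₀ CE u Grid) (hle : CE ≤ CE') : TowerGridMomentsStepG P R Q₀ CE' u Grid :=
  fun Q hQ hCE => h Q hQ (hle.trans hCE)

/-- `TowerGridMomentsStepG` is antitone in the threshold. -/
theorem TowerGridMomentsStepG.anti_u (h : TowerGridMomentsStepG P R Q₀ CE u Grid) (hle : ∀ Q cc, u' Q cc ≤ u Q cc) :
    TowerGridMomentsStepG P R Q₀ CE u' Grid :=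
  fun Q hQ hCE cc hcc hcc6 μ hμ U hU hU10 hUu => h Q hQ hCE cc hcc hcc6 μ hμ U hU hU10 (hUu.trans (hle Q cc))

/-- `TowerGridMomentsStepG` is monotone in the atom. -/
theorem TowerGridMomentsStepG.mono_grid (h : TowerGridMomentsStepG P R Q₀ CE u Grid)
    (hG : ∀ (L M : ℕ) [NeZero L] [NeZero M] (cc β U μ : ℝ) (n : ℕ), Grid L M cc β U μ n → Grid' L M cc β U μ n) :
    TowerGridMomentsStepG P R Q₀ CE u Grid' :=
  fun Q hQ hCE cc hcc hcc6 μ hμ U hU hU10 hUu β hβ hβc L M _ _ hL hM n hn1 hn hreg hhist hfr hlevU =>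
    hG L M cc β U μ n (h Q hQ hCE cc hcc hcc6 μ hμ U hU hU10 hUu β hβ hβc L M hL hM n hn1 hn hreg hhist hfr hlevU)

/-- **A grid threshold below the key's own `CE` is inert**: every raise `Q` of `Q₀` has `Q₀.CE ≤ Q.CE`, so a grid package at threshold `CE ≤ Q₀.CE` serves every
candidate constant `CE'`. -/
theorem TowerGridMomentsStepG.of_le_key (h : TowerGridMomentsStepG P R Q₀ CE u Grid) (hle : CE ≤ Q₀.CE) (CE' : ℝ) :
    TowerGridMomentsStepG P R Q₀ CE' u Grid :=
  fun Q hQ _ => h Q hQ (hle.trans hQ.CE_le)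

/-- Projection: the generic deliverable gives the levels part. -/
theorem TowerNormsStepG.levels (h : TowerNormsStepG P R Q₀ CE u Grid) : TowerLevelsStep P R Q₀ CE u :=
  fun Q hQ hCE cc hcc hcc6 μ hμ U hU hU10 hUu β hβ hβc L M _ _ hL hM n hn1 hn hreg hhist hfr hlevU j _ hj =>
    (h Q hQ hCE cc hcc hcc6 μ hμ U hU hU10 hUu β hβ hβc L M hL hM n hn1 hn hreg hhist hfr hlevU).2.1 j hj

/-- Projection: the generic deliverable gives the first-moments part. -/
theorem TowerNormsStepG.firstMoments (h : TowerNormsStepG P R Q₀ CE u Grid) : TowerFirstMomentsStep P R Q₀ CE u :=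
  fun Q hQ hCE cc hcc hcc6 μ hμ U hU hU10 hUu β hβ hβc L M _ _ hL hM n hn1 hn hreg hhist hfr hlevU =>
    (h Q hQ hCE cc hcc hcc6 μ hμ U hU hU10 hUu β hβ hβc L M hL hM n hn1 hn hreg hhist hfr hlevU).2.2.1

/-- Projection: the generic deliverable gives the generic grid part. -/
theorem TowerNormsStepG.grid (h : TowerNormsStepG P R Q₀ CE u Grid) : TowerGridMomentsStepG P R Q₀ CE u Grid :=
  fun Q hQ hCE cc hcc hcc6 μ hμ U hU hU10 hUu β hβ hβc L M _ _ hL hM n hn1 hn hreg hhist hfr hlevU =>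
    (h Q hQ hCE cc hcc hcc6 μ hμ U hU hU10 hUu β hβ hβc L M hL hM n hn1 hn hreg hhist hfr hlevU).2.2.2

end Rows

/-! ### The assembly, atom-generic (part 12's `towerNormsStep_of_parts` with conjunct (4) := the atom) -/

section Assembly

variable {P : SplitConsts} {R : RenConsts} {Q₀ : EngConsts} {Grid : GridAtom}

/-- **Top layer, atom-generic.**  For any key `Q₀` that is a raise of `klEngQ7 P R`, the levels part at `(CEℓ, uℓ)`, the first-moments part at `(CE₄, u₄)` and
the generic grid part at `(CEg, ug)` give `TowerNormsStepG P R Q₀ (max CEℓ (max CE₄ CEg)) (uℓ ⊓ u₄ ⊓ ug) Grid` (conjunct (1) = conjunct (2) at `j = n`; level `0` =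
the scale-0 rung at `K_n`). -/
theorem towerNormsStepG_of_parts {CEℓ CE₄ CEg : ℝ} {uℓ u₄ ug : EngConsts → ℝ → ℝ} (hP : P.WF) (hR : R.WF2) (hQ₀ : (klEngQ7 P R).IsRaiseOf Q₀)
    (hℓ : TowerLevelsStep P R Q₀ CEℓ uℓ) (h₄ : TowerFirstMomentsStep P R Q₀ CE₄ u₄) (hg : TowerGridMomentsStepG P R Q₀ CEg ug Grid) :
    TowerNormsStepG P R Q₀ (max CEℓ (max CE₄ CEg)) (fun Q cc => min (uℓ Q cc) (min (u₄ Q cc) (ug Q cc))) Grid := by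
  intro Q hQ hCE cc hcc hcc6 μ hμ U hU hU10 hUu β hβ hβc L M _ _ hL hM n hn1 hn hreg hhist hfr hlevU
  have hCEℓ : CEℓ ≤ Q.CE := (le_max_left _ _).trans hCE
  have hCE₄ : CE₄ ≤ Q.CE := ((le_max_left _ _).trans (le_max_right _ _)).trans hCE
  have hCEg : CEg ≤ Q.CE := ((le_max_right _ _).trans (le_max_right _ _)).trans hCE
  have hUℓ : U ≤ uℓ Q cc := hUu.trans (min_le_left _ _)
  have hU₄ : U ≤ u₄ Q cc := hUu.trans ((min_le_right _ _).trans (min_le_left _ _))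
  have hUg : U ≤ ug Q cc := hUu.trans ((min_le_right _ _).trans (min_le_right _ _))
  have hβ0 : 0 ≤ β := le_trans (by norm_num [klBetaMin]) hβ
  have h0 := levelZero_norms_frame_of_isRaiseOf_U10L4 P R Q (hQ₀.trans hQ) cc hP hR hcc hcc6 μ hμ U hU hU10 β hβ hβc
    (klFlowFrameU L M β U μ n) hfr L M hL hM
  have hlev : ∀ j ≤ n, KernelNormsLevels L M P Q β U μ (klFlowFrameU L M β U μ n) j ∧
      KernelNormsWt4 L M (klWtBudget P Q U j) β U μ (klFlowFrameU L M β U μ n) j := by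
    intro j hj
    rcases Nat.eq_zero_or_pos j with rfl | hj1
    · exact ⟨h0.2.1, h0.2.2⟩
    · exact hℓ Q hQ hCEℓ cc hcc hcc6 μ hμ U hU hU10 hUℓ β hβ hβc L M hL hM n hn1 hn hreg hhist hfr hlevU j hj1 hj
  refine ⟨kernelNormsV4_of_kernelNormsWt4_klWtBudget hβ0 (hlev n le_rfl).2, hlev, ?_, ?_⟩
  · exact h₄ Q hQ hCE₄ cc hcc hcc6 μ hμ U hU hU10 hU₄ β hβ hβc L M hL hM n hn1 hn hreg hhist hfr hlevU
  · exact hg Q hQ hCEg cc hcc hcc6 μ hμ U hU hU10 hUg β hβ hβc L M hL hM n hn1 hn hreg hhist hfr hlevU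

/-- **`∃`-form, atom-generic**: admissible packages for the three parts give an admissible package for the generic deliverable. -/
theorem exists_towerPkgG_of_parts (hP : P.WF) (hR : R.WF2) (hQ₀ : (klEngQ7 P R).IsRaiseOf Q₀)
    (hℓ : ∃ e : ℝ × (EngConsts → ℝ → ℝ), IsTowerPkg e ∧ TowerLevelsStep P R Q₀ e.1 e.2)
    (h₄ : ∃ e : ℝ × (EngConsts → ℝ → ℝ), IsTowerPkg e ∧ TowerFirstMomentsStep P R Q₀ e.1 e.2)
    (hg : ∃ e : ℝ × (EngConsts → ℝ → ℝ), IsTowerPkg e ∧ TowerGridMomentsStepG P R Q₀ e.1 e.2 Grid) :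
    ∃ e : ℝ × (EngConsts → ℝ → ℝ), IsTowerPkg e ∧ TowerNormsStepG P R Q₀ e.1 e.2 Grid := by
  obtain ⟨⟨CEℓ, uℓ⟩, ⟨hℓ0, hℓu⟩, hℓ⟩ := hℓ
  obtain ⟨⟨CE₄, u₄⟩, ⟨_, h₄u⟩, h₄⟩ := h₄
  obtain ⟨⟨CEg, ug⟩, ⟨_, hgu⟩, hg⟩ := hg
  exact ⟨(max CEℓ (max CE₄ CEg), fun Q cc => min (uℓ Q cc) (min (u₄ Q cc) (ug Q cc))),
    ⟨le_max_of_le_left hℓ0, fun Q cc => lt_min (hℓu Q cc) (lt_min (h₄u Q cc) (hgu Q cc))⟩,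
    towerNormsStepG_of_parts hP hR hQ₀ hℓ h₄ hg⟩

end Assembly

/-! ## §2 The atom-free core package, the key-threshold grid package and the generic closer -/

/-- **`TowerCoreStep P R Q₀ CE u`** — the ATOM-FREE CORE of the deliverable: the levels part and the first-moments part (conjuncts (2)–(3); conjunct (1) and
level `0` follow by the assembly).  No grid atom occurs in it. -/
def TowerCoreStep (P : SplitConsts) (R : RenConsts) (Q₀ : EngConsts) (CE : ℝ) (u : EngConsts → ℝ → ℝ) : Prop :=
  TowerLevelsStep P R Q₀ CE u ∧ TowerFirstMomentsStep P R Q₀ CE u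

section Core

variable {P : SplitConsts} {R : RenConsts} {Q₀ : EngConsts} {CE CE' : ℝ} {u u' : EngConsts → ℝ → ℝ}

/-- `TowerCoreStep` is monotone in the candidate constant. -/
theorem TowerCoreStep.mono_CE (h : TowerCoreStep P R Q₀ CE u) (hle : CE ≤ CE') : TowerCoreStep P R Q₀ CE' u :=
  ⟨h.1.mono_CE hle, h.2.mono_CE hle⟩

/-- `TowerCoreStep` is antitone in the threshold. -/
theorem TowerCoreStep.anti_u (h : TowerCoreStep P R Q₀ CE u) (hle : ∀ Q cc, u' Q cc ≤ u Q cc) : TowerCoreStep P R Q₀ CE u' :=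
  ⟨h.1.anti_u hle, h.2.anti_u hle⟩

/-- **The core package from a levels package and W3's class-#4 witness** (`towerFirstMomentsStep_of_e4Pack`): constant = the levels constant, threshold =
`uℓ ⊓ klE4UF klEngGeo8 P R`. -/
theorem exists_towerCorePkg_of_levels_e4 (hP : P.WF) (hR : R.WF2) (hQ₀ : (klEngQ7 P R).IsRaiseOf Q₀)
    (hℓ : ∃ e : ℝ × (EngConsts → ℝ → ℝ), IsTowerPkg e ∧ TowerLevelsStep P R Q₀ e.1 e.2)
    (hE : ∃ Eu : ℝ × (GeoConsts → SplitConsts → RenConsts → EngConsts → ℝ → ℝ),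
      0 ≤ Eu.1 ∧ (∀ G P R Q cc, 0 < Eu.2 G P R Q cc) ∧ E4FlowAt Eu.1 Eu.2) :
    ∃ e : ℝ × (EngConsts → ℝ → ℝ), IsTowerPkg e ∧ TowerCoreStep P R Q₀ e.1 e.2 := by
  obtain ⟨⟨CEℓ, uℓ⟩, ⟨hℓ0, hℓu⟩, hℓ⟩ := hℓ
  refine ⟨(CEℓ, fun Q cc => min (uℓ Q cc) (klE4UF klEngGeo8 P R Q cc)),
    ⟨hℓ0, fun Q cc => lt_min (hℓu Q cc) (klE4UF_pos klEngGeo8 P R Q cc)⟩, ?_, ?_⟩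
  · exact hℓ.anti_u fun Q cc => min_le_left _ _
  · exact (towerFirstMomentsStep_of_e4Pack hP hR hQ₀ hE CEℓ).anti_u fun Q cc => min_le_right _ _

end Core

section Deferred

variable (P : SplitConsts) (R : RenConsts)

/-- **The deferred CORE package `klTowerCorePkg P R`**: SOME admissible `(CE, u)` with `TowerCoreStep P R (klEngQ8 P R) CE u`, if one exists, ELSE the default
`(|(klEngQ8 P R).CE|, fun _ _ => 1)`.  It does not read any grid atom. -/
def klTowerCorePkg : ℝ × (EngConsts → ℝ → ℝ) :=
  open scoped Classical in
  if h : ∃ e : ℝ × (EngConsts → ℝ → ℝ), IsTowerPkg e ∧ TowerCoreStep P R (klEngQ8 P R) e.1 e.2 then Classical.choose h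
  else (|(klEngQ8 P R).CE|, fun _ _ => 1)

/-- **The tower's ATOM-FREE public constant `klTowerCoreCE P R`** (successor row of token #13: `e_T := max (klEngQ8 P R).CE (klTowerCoreCE P R)`). -/
def klTowerCoreCE : ℝ := (klTowerCorePkg P R).1

/-- **The core's CE-aware coupling threshold `klTowerCoreU P R Q cc`.** -/
def klTowerCoreU : EngConsts → ℝ → ℝ := (klTowerCorePkg P R).2

/-- The deferred core package is admissible (unconditionally). -/
theorem isTowerPkg_klTowerCorePkg : IsTowerPkg (klTowerCorePkg P R) := by
  classical
  unfold klTowerCorePkg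
  split_ifs with h
  · exact (Classical.choose_spec h).1
  · exact isTowerPkg_default _

/-- `0 ≤ klTowerCoreCE P R` (unconditionally). -/
theorem klTowerCoreCE_nonneg : 0 ≤ klTowerCoreCE P R := (isTowerPkg_klTowerCorePkg P R).1

/-- `0 < klTowerCoreU P R Q cc` (unconditionally). -/
theorem klTowerCoreU_pos (Q : EngConsts) (cc : ℝ) : 0 < klTowerCoreU P R Q cc := (isTowerPkg_klTowerCorePkg P R).2 Q cc

/-- `(klEngQ8 P R).CE ≤ max (klEngQ8 P R).CE (klTowerCoreCE P R)` (the successor `e_T` dominates the key's constant). -/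
theorem klEngQ8_CE_le_max_klTowerCoreCE : (klEngQ8 P R).CE ≤ max (klEngQ8 P R).CE (klTowerCoreCE P R) := le_max_left _ _

/-- `klTowerCoreCE P R ≤ max (klEngQ8 P R).CE (klTowerCoreCE P R)` (what the generic closer feeds as `CE ≤ Q.CE` at the successor key). -/
theorem klTowerCoreCE_le_max_klEngQ8_CE : klTowerCoreCE P R ≤ max (klEngQ8 P R).CE (klTowerCoreCE P R) := le_max_right _ _

/-- **The deferred KEY-THRESHOLD grid package `klTowerGridU P R Grid`**: SOME everywhere-positive threshold `u` with
`TowerGridMomentsStepG P R (klEngQ8 P R) (klEngQ8 P R).CE u Grid` (the grid part for EVERY raise of the key), if one exists, ELSE `fun _ _ => 1`. -/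
def klTowerGridU (Grid : GridAtom) : EngConsts → ℝ → ℝ :=
  open scoped Classical in
  if h : ∃ u : EngConsts → ℝ → ℝ, (∀ Q cc, 0 < u Q cc) ∧ TowerGridMomentsStepG P R (klEngQ8 P R) (klEngQ8 P R).CE u Grid then Classical.choose h
  else fun _ _ => 1

/-- `0 < klTowerGridU P R Grid Q cc` (unconditionally). -/
theorem klTowerGridU_pos (Grid : GridAtom) (Q : EngConsts) (cc : ℝ) : 0 < klTowerGridU P R Grid Q cc := by
  classical
  unfold klTowerGridU
  split_ifs with h
  · exact (Classical.choose_spec h).1 Q cc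
  · exact one_pos

/-- **The generic tower threshold `klTowerUG P R Grid Q cc := min (klTowerCoreU P R Q cc) (klTowerGridU P R Grid Q cc)`** (successor DefsU11 row
`⊓ klTowerUG P R (klTowerGrid P R) (QT P R) cc`). -/
def klTowerUG (Grid : GridAtom) : EngConsts → ℝ → ℝ := fun Q cc => min (klTowerCoreU P R Q cc) (klTowerGridU P R Grid Q cc)

/-- `0 < klTowerUG P R Grid Q cc` (unconditionally). -/
theorem klTowerUG_pos (Grid : GridAtom) (Q : EngConsts) (cc : ℝ) : 0 < klTowerUG P R Grid Q cc :=
  lt_min (klTowerCoreU_pos P R Q cc) (klTowerGridU_pos P R Grid Q cc)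

/-- The generic package `(klTowerCoreCE P R, klTowerUG P R Grid)` is admissible (unconditionally). -/
theorem isTowerPkg_klTowerCore_klTowerUG (Grid : GridAtom) : IsTowerPkg (klTowerCoreCE P R, klTowerUG P R Grid) :=
  ⟨klTowerCoreCE_nonneg P R, klTowerUG_pos P R Grid⟩

variable {P R}

/-- **The core holds for the deferred core package as soon as it holds for some admissible package** (`choose_spec`). -/
theorem towerCoreStep_klTowerCore_of_exists (h : ∃ e : ℝ × (EngConsts → ℝ → ℝ), IsTowerPkg e ∧ TowerCoreStep P R (klEngQ8 P R) e.1 e.2) :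
    TowerCoreStep P R (klEngQ8 P R) (klTowerCoreCE P R) (klTowerCoreU P R) := by
  classical
  have hpkg : klTowerCorePkg P R = Classical.choose h := by
    unfold klTowerCorePkg
    rw [dif_pos h]
  unfold klTowerCoreCE klTowerCoreU
  rw [hpkg]
  exact (Classical.choose_spec h).2

/-- **The grid part holds for the deferred key-threshold package as soon as some everywhere-positive threshold serves every raise of the key** (`choose_spec`). -/
theorem towerGridMomentsStepG_klTowerGridU_of_exists {Grid : GridAtom}
    (h : ∃ u : EngConsts → ℝ → ℝ, (∀ Q cc, 0 < u Q cc) ∧ TowerGridMomentsStepG P R (klEngQ8 P R) (klEngQ8 P R).CE u Grid) :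
    TowerGridMomentsStepG P R (klEngQ8 P R) (klEngQ8 P R).CE (klTowerGridU P R Grid) Grid := by
  classical
  have hpkg : klTowerGridU P R Grid = Classical.choose h := by
    unfold klTowerGridU
    rw [dif_pos h]
  rw [hpkg]
  exact (Classical.choose_spec h).2

/-- A grid package at ANY threshold below the key's constant is a key-threshold package (`of_le_key`). -/
theorem exists_gridU_of_pkg_le_key {Grid : GridAtom}
    (hg : ∃ e : ℝ × (EngConsts → ℝ → ℝ), IsTowerPkg e ∧ e.1 ≤ (klEngQ8 P R).CE ∧ TowerGridMomentsStepG P R (klEngQ8 P R) e.1 e.2 Grid) :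
    ∃ u : EngConsts → ℝ → ℝ, (∀ Q cc, 0 < u Q cc) ∧ TowerGridMomentsStepG P R (klEngQ8 P R) (klEngQ8 P R).CE u Grid := by
  obtain ⟨⟨CEg, ug⟩, ⟨_, hgu⟩, hle, hg⟩ := hg
  exact ⟨ug, hgu, hg.of_le_key hle _⟩

/-- **THE GENERIC CLOSER.**  A core package and a key-threshold grid package for the atom `Grid` give the generic deliverable AT THE ATOM-FREE CONSTANT:
`TowerNormsStepG P R (klEngQ8 P R) (klTowerCoreCE P R) (klTowerUG P R Grid) Grid`.  (Either branch of the 08-28 decision instantiates `Grid`; the constant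
does not move.) -/
theorem towerNormsStepG_klTowerG_of_exists {Grid : GridAtom} (hP : P.WF) (hR : R.WF2)
    (hc : ∃ e : ℝ × (EngConsts → ℝ → ℝ), IsTowerPkg e ∧ TowerCoreStep P R (klEngQ8 P R) e.1 e.2)
    (hg : ∃ u : EngConsts → ℝ → ℝ, (∀ Q cc, 0 < u Q cc) ∧ TowerGridMomentsStepG P R (klEngQ8 P R) (klEngQ8 P R).CE u Grid) :
    TowerNormsStepG P R (klEngQ8 P R) (klTowerCoreCE P R) (klTowerUG P R Grid) Grid := by
  have hcore := towerCoreStep_klTowerCore_of_exists hc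
  have hgrid := (towerGridMomentsStepG_klTowerGridU_of_exists hg).of_le_key le_rfl (klTowerCoreCE P R)
  have h := towerNormsStepG_of_parts hP hR (isRaiseOf_klEngQ8 P R) hcore.1 hcore.2 hgrid
  rw [max_self, max_self] at h
  exact h.anti_u fun Q cc =>
    show min (klTowerCoreU P R Q cc) (klTowerGridU P R Grid Q cc) ≤ _ from
      le_min (min_le_left _ _) (le_min (min_le_left _ _) (min_le_right _ _))

/-- **Generic closer, explicit-witness form**: a levels package, W3's class-#4 witness and a key-threshold grid package for `Grid`. -/
theorem towerNormsStepG_klTowerG_of_levels_e4_grid {Grid : GridAtom} (hP : P.WF) (hR : R.WF2)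
    (hℓ : ∃ e : ℝ × (EngConsts → ℝ → ℝ), IsTowerPkg e ∧ TowerLevelsStep P R (klEngQ8 P R) e.1 e.2)
    (hE : ∃ Eu : ℝ × (GeoConsts → SplitConsts → RenConsts → EngConsts → ℝ → ℝ),
      0 ≤ Eu.1 ∧ (∀ G P R Q cc, 0 < Eu.2 G P R Q cc) ∧ E4FlowAt Eu.1 Eu.2)
    (hg : ∃ u : EngConsts → ℝ → ℝ, (∀ Q cc, 0 < u Q cc) ∧ TowerGridMomentsStepG P R (klEngQ8 P R) (klEngQ8 P R).CE u Grid) :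
    TowerNormsStepG P R (klEngQ8 P R) (klTowerCoreCE P R) (klTowerUG P R Grid) Grid :=
  towerNormsStepG_klTowerG_of_exists hP hR (exists_towerCorePkg_of_levels_e4 hP hR (isRaiseOf_klEngQ8 P R) hℓ hE) hg

end Deferred

/-! ## §3 Both tables from the same two inputs -/

section Tables

variable {P : SplitConsts} {R : RenConsts}

/-- **At the atom of record, the generic deliverable is the deliverable of record** (reader for the (b) v2 closer if conj. 4's text does not move). -/
theorem towerNormsStep_of_towerNormsStepG {Q₀ : EngConsts} {CE : ℝ} {u : EngConsts → ℝ → ℝ}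
    (h : TowerNormsStepG P R Q₀ CE u (klGridAtomA R)) : TowerNormsStep P R Q₀ CE u :=
  towerNormsStepG_klGridAtomA_iff.mp h

/-- **Today's table (DefsQ9's `klTowerPkg` route) from the same two inputs**: a core package and a key-threshold grid package at the atom of record give
`∃ e, IsTowerPkg e ∧ TowerNormsStep P R (klEngQ8 P R) e.1 e.2` — the hypothesis of `towerNormsStep_klTower_of_exists`. -/
theorem exists_towerPkg_of_core_grid (hP : P.WF) (hR : R.WF2)
    (hc : ∃ e : ℝ × (EngConsts → ℝ → ℝ), IsTowerPkg e ∧ TowerCoreStep P R (klEngQ8 P R) e.1 e.2)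
    (hg : ∃ u : EngConsts → ℝ → ℝ, (∀ Q cc, 0 < u Q cc) ∧
      TowerGridMomentsStepG P R (klEngQ8 P R) (klEngQ8 P R).CE u (klGridAtomA R)) :
    ∃ e : ℝ × (EngConsts → ℝ → ℝ), IsTowerPkg e ∧ TowerNormsStep P R (klEngQ8 P R) e.1 e.2 :=
  ⟨(klTowerCoreCE P R, klTowerUG P R (klGridAtomA R)), isTowerPkg_klTowerCore_klTowerUG P R _,
    towerNormsStep_of_towerNormsStepG (towerNormsStepG_klTowerG_of_exists hP hR hc hg)⟩

/-- … hence today's deferred row `TowerNormsStep P R (klEngQ8 P R) (klTowerCE P R) (klTowerU P R)` from the same two inputs. -/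
theorem towerNormsStep_klTower_of_core_grid (hP : P.WF) (hR : R.WF2)
    (hc : ∃ e : ℝ × (EngConsts → ℝ → ℝ), IsTowerPkg e ∧ TowerCoreStep P R (klEngQ8 P R) e.1 e.2)
    (hg : ∃ u : EngConsts → ℝ → ℝ, (∀ Q cc, 0 < u Q cc) ∧
      TowerGridMomentsStepG P R (klEngQ8 P R) (klEngQ8 P R).CE u (klGridAtomA R)) :
    TowerNormsStep P R (klEngQ8 P R) (klTowerCE P R) (klTowerU P R) :=
  towerNormsStep_klTower_of_exists (exists_towerPkg_of_core_grid hP hR hc hg)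

/-- **The successor table's reader**: at any raise `Q` of the key with `max (klEngQ8 P R).CE (klTowerCoreCE P R) ≤ Q.CE` (the successor key has
`CE := max (klEngQ8 P R).CE (klTowerCoreCE P R)`) the generic deliverable's `CE ≤ Q.CE` binder is met. -/
theorem klTowerCoreCE_le_of_max_le {Q : EngConsts} (hCE : max (klEngQ8 P R).CE (klTowerCoreCE P R) ≤ Q.CE) : klTowerCoreCE P R ≤ Q.CE :=
  (klTowerCoreCE_le_max_klEngQ8_CE P R).trans hCE

end Tables

end Summit.HubbardSuperconductivity.HubbardSuperconductivity.Theorems.EngineV8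

end
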